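import Literature.MathematicalPhysics.QuantumFieldTheory.Balaban1983to89.T4InputCauchyRateSecant
import Summits.QuantumFields.BalabanUV.T4Continuum.Support.InsertionLinearRate

/-!
# NE5 ∕ U3 — row O1-f ADMISSIBLE BASE: the BUDGET-BOX base of a step model — `BaseBudget` BY CONSTRUCTION, leaf L03 `InBase`
# ⇔ run B's two ONE-RUN budgets, and the history budget ⇐ the printed one-run level `DecayBound` (leaf L06) through the LINEAR
# insertion class (the (1.36) mechanism of [Balaban1988RG2Cluster] Lemma 1∕2)
# (claim table `t4/b2b-balaban-t4-ne5-p1/O1-CLAIM-TABLE-NE5-P1.md` row O1-f; design `B13StepDesign.md` v0.2 RULES R5∕R6)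

Cell `pub-balaban`, unit `b2b-balaban-t4-ne5-formalise-leaf-03` (NE5 formalisation swarm, LEAF PROVER 03; journal CLAIM O1-f
2026-08-20T05:31:32Z).  Summits-side new work under the LEAN PLACEMENT RULE (cell modelling + bookkeeping; NOT a Literature
module).  HONEST FRAMING: rung (B)+1 of the FINITE-VOLUME T⁴ continuum programme — NOT infinite volume, NOT a mass gap, NOT the
Clay problem, NOT a proof of NE5 (NOT PRINTED in [Balaban1987RG1]–[Balaban1989LargeFieldII]; they print ε-UNIFORM bounds, never
η-RATES).  HONEST DEPENDENCY (cell line, verbatim): continuum YM on T⁴ ⇐ BetaPertH ∧ nine spine estimates (0/9 proved);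
BetaPertH ⇐ (D1) ∧ (D4) ∧ CAP+tail; G-an2-4 gates asym, D1 and NE2/3/4.

WHAT THIS FILE DOES.  Every END face of the input-interpolation Cauchy route to NE5 (`StepModel.ne5_at_of_stepModel_lip_nat`,
`T4InputCauchyRateSpecies.ne5_at_of_stepModel_budget_scale_nat`, `T4InputCauchyRateSecant.ne5_at_of_stepModel_secant_nat`,
`OutputRateTowerInstance.ne5_at_of_perturbed_split_readsIns_nat`, …) consumes `hbase : M.InBase EB W` (leaf L03: run B's data lie
in the model's admissible base `M.Base k g U`, where W2 is asserted) and, on the budget∕secant faces, `BaseBudget M W ctr BOp BHist`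
∕ `HistBudgetA M ctr EA W BHistA`.  Design RULE R5 reads Bałaban's base as «{operators obeying the (1.5)∕(1.7)-type bounds} ×
{potentials analytic on (1.34) with (1.36)∕(1.43)-budget}» — the ONE-RUN inductive hypotheses of [Balaban1988RG2Cluster] (= [II]) —
and RULE R6 (record §27) puts W2 on that budget ball DILATED by the margins.  In the normed typing of rows O1-b∕O1-c (species norms
= the weighted sup norms of (1.7)∕(1.36)∕(1.43); analyticity on (1.34) in the TYPE of a history datum) the base is a BUDGET BOX,
a product of two closed balls about a class centre.  Typed here GENERICALLY over the step model (composes with rows O1-a–e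
whatever their carriers and species); proved, with no estimate anywhere:
* §1 `HasBudgetBase M ctr BOp BHist` (the `Base` IS `ballClass ctr BOp BHist`, the lineage's DICTIONARY by name); the installer
  `StepModel.withBase` (every base-free END-face binder unchanged, `Iff.rfl`); `BaseBudget` BY CONSTRUCTION; **`InBase ↔ OpBudgetB
  ∧ HistBudgetB`** (`inBase_iff_budgets`) — leaf L03 IS the pair of run B's ONE-RUN budgets: operators within `BOp k` of the
  centre ((1.5)∕(1.7)-KIND), inserted history within `BHist k` ((1.36)∕(1.43)-KIND); conversely ANY base with `InBase ∧
  BaseBudget` yields them (`budgets_of_inBase_baseBudget`: the budget box is the least such base); the SLACK of the roomy ball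
  class (`boxInClass_of_hasBudgetBase`, = `boxInClass_of_baseBudget` BY NAME);
* §2 the SELF-CENTRED operator dictionary of `BaseBudget`'s docstring («the centre's operators ARE the step's operators»):
  `selfCtr`, `opBudgetB_selfCtr` — operator budget `0`; the operator species enter the class reading through ROOM only;
* §3 THE (1.36) MECHANISM, typed: for insertions read from the LINEAR class `InsertionLinearClass.LinearInsertion` (printed
  STRUCTURE, [II] (1.33) p. 9 ∕ (1.41) p. 11: `ins t = base + Σ_{Y ∈ dom k} (t Y)•vec Y`) a table of one-run level `T·e^{−κd}`
  moves the inserted history off its base part by ≤ `T·Σ_Y e^{−κd(Y)}‖vec Y‖` (`norm_ins_sub_base_le`); the TOTAL weighted budget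
  `VecBudget` FOLLOWS from the already-displayed W3 binder `AgeBudget` by the geometric age sum (`vecBudget_of_ageBudget`,
  `V k = rHist k·c/(1 − ω)`); hence `histBudgetB_of_linear`: `ReadsB ∧ VecBudget ∧ DecayBound EB W E₀ κ ⟹ HistBudgetB` with
  `BHist = E₀·V` about the centre `ctr.2 = LB.base` — run B's history budget from the PRINTED one-run level (leaf L06,
  [Balaban1987RG1] (1.18) p. 263, quoted as a hypothesis SHAPE) and the W3-KIND budget, NO new binder kind; the A-twin
  `histBudgetA_of_linear` (+ the displayed NE2-TYPE `BaseRate` of `InsertionLinearRate`) feeds the secant face's `HistBudgetA`;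
* §4 assembled: `inBase_of_linear`; `inBase_baseBudget_of_selfCtr_ageBudget` — install `selfBudgetBase M LB E₀ c ω` (budgets
  `(0, E₀·rHist·c/(1 − ω))` about `selfCtr M LB.base`); then `ReadsB ∧ AgeBudget LB ∧ DecayBound EB` (+ signs) give BOTH `InBase`
  (L03) and `BaseBudget` for the installed model; `boxInClass_of_selfCtr` (room ⟹ slack);
* §5 toy on the class file's toy carriers: non-vacuity of §4 (every hypothesis met; the toy's actual displacement at step `k` is
  the partial geometric sum `Σ_{m<k} ω^m ↑ 1/(1 − ω)` = the installed budget, so the budget is not improvable uniformly in `k`).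
WHAT REMAINS OPEN (honest): that Bałaban's step operators and §1-potentials of [II] ARE such data with these budgets is rows
O1-b∕O1-c∕O4 (typing + readings); the class bound on the roomy ball is the wall O2 (NOT PRINTED, GAPS G-ne5p1-1′).  Nothing of the
manuscripts under audit is asserted; they are cited for KIND∕locus only ([II] p. 3 (1.5)∕(1.7), p. 9 (1.34)∕(1.36), p. 11 (1.43),
p. 22 «completes the proof of the inductive assumptions for the action A_{k+1}»; [Balaban1987RG1] Thm 1 p. 259, (1.18) p. 263).
0 sorry; no new axioms.
-/

open scoped BigOperators
open Metric Set Finset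

namespace Summit.QuantumFields.BalabanUV.T4Continuum.B13Base

open Literature.MathematicalPhysics.QuantumFieldTheory.Balaban1983to89.T4OutputRate (Carriers Functional DecayBound)
open Literature.MathematicalPhysics.QuantumFieldTheory.Balaban1983to89.T4InputCauchyRateData (StepModel tableA tableB)
open Literature.MathematicalPhysics.QuantumFieldTheory.Balaban1983to89.T4InputCauchyRateSpecies
  (ballClass BaseBudget BoxInClass boxInClass_of_baseBudget)
open Literature.MathematicalPhysics.QuantumFieldTheory.Balaban1983to89.T4InputCauchyRateSecant (HistBudgetA)
open Summit.QuantumFields.BalabanUV.T4Continuum.InsertionLinearClass (LinearInsertion)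
open Summit.QuantumFields.BalabanUV.T4Continuum.InsertionLinearRate.LinearPair (ReadsB BaseRate)

variable {C : Carriers} {Op Hist : Type*} [NormedAddCommGroup Op] [NormedSpace ℂ Op] [NormedAddCommGroup Hist]
  [NormedSpace ℂ Hist]

/-! ## §1 The budget-box base: `BaseBudget` by construction, `InBase ↔` run B's two one-run budgets -/

section BudgetBox

variable (M : StepModel C Op Hist)

/-- [folklore] DICTIONARY (no inequality inside): the model's admissible base at step `k` IS the BUDGET BOX
`ballClass ctr BOp BHist k g U = B̄((ctr k g U).1, BOp k) × B̄((ctr k g U).2, BHist k)` — design RULE R5 («{operators obeying the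
(1.5)∕(1.7)-type bounds} × {potentials with (1.36)∕(1.43)-budget}», [Balaban1988RG2Cluster] p. 3, p. 9, p. 11: KIND only). -/
def HasBudgetBase (ctr : ℕ → (ℕ → ℝ) → C.BgB → Op × Hist) (BOp BHist : ℕ → ℝ) : Prop :=
  ∀ k (g : ℕ → ℝ) (U : C.BgB), M.Base k g U = ballClass ctr BOp BHist k g U

/-- [folklore] INSTALLER: the same step model with its admissible base replaced by `B` — output functional, both runs' data maps
and insertions, both margins UNCHANGED (so every END-face binder not mentioning the base is unchanged on the nose). -/
def _root_.Literature.MathematicalPhysics.QuantumFieldTheory.Balaban1983to89.T4InputCauchyRateData.StepModel.withBase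
    (B : ℕ → (ℕ → ℝ) → C.BgB → Set (Op × Hist)) : StepModel C Op Hist where
  Out := M.Out
  opA := M.opA
  opB := M.opB
  insA := M.insA
  insB := M.insB
  Base := B
  rOp := M.rOp
  rHist := M.rHist
  rOp_pos := M.rOp_pos
  rHist_pos := M.rHist_pos

/-- [folklore] The installed base. -/
@[simp] theorem withBase_base (B : ℕ → (ℕ → ℝ) → C.BgB → Set (Op × Hist)) : (M.withBase B).Base = B := rfl

/-- [folklore] Installing the budget box gives `HasBudgetBase` on the nose. -/
theorem hasBudgetBase_withBase (ctr : ℕ → (ℕ → ℝ) → C.BgB → Op × Hist) (BOp BHist : ℕ → ℝ) :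
    HasBudgetBase (M.withBase (ballClass ctr BOp BHist)) ctr BOp BHist := fun _ _ _ => rfl

/-- [folklore] Base-free binders are unchanged by the installer (definitionally): the two representations (L01∕L02), W1, W4, W3
(natural form), the structural insertion binders and the single-scale bound, the readings of the linear insertion class (both
runs) and its age budget. -/
theorem withBase_binders {B : ℕ → (ℕ → ℝ) → C.BgB → Set (Op × Hist)} {EA : Functional C C.BgA} {EB : Functional C C.BgB}
    {W : Set (ℕ → ℝ)} {LA LB : LinearInsertion C Hist} {κ E₀ E₁ δ δ' θ c ω : ℝ} :
    ((M.withBase B).RepresentsA EA W ↔ M.RepresentsA EA W) ∧ ((M.withBase B).RepresentsB EB W ↔ M.RepresentsB EB W) ∧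
      ((M.withBase B).OperatorRate W δ θ ↔ M.OperatorRate W δ θ) ∧
      ((M.withBase B).InsertionRate W κ E₀ δ' θ ↔ M.InsertionRate W κ E₀ δ' θ) ∧
      ((M.withBase B).InsertionDampedNat W κ c ω ↔ M.InsertionDampedNat W κ c ω) ∧
      ((M.withBase B).InsAffine W ↔ M.InsAffine W) ∧ ((M.withBase B).InsBlind W ↔ M.InsBlind W) ∧
      ((M.withBase B).InsHomog W ↔ M.InsHomog W) ∧ ((M.withBase B).InsScaleBound W κ E₁ c ω ↔ M.InsScaleBound W κ E₁ c ω) ∧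
      (LA.Reads (M.withBase B) W ↔ LA.Reads M W) ∧ (ReadsB LB (M.withBase B) W ↔ ReadsB LB M W) ∧
      (LA.AgeBudget (M.withBase B) W κ c ω ↔ LA.AgeBudget M W κ c ω) :=
  ⟨Iff.rfl, Iff.rfl, Iff.rfl, Iff.rfl, Iff.rfl, Iff.rfl, Iff.rfl, Iff.rfl, Iff.rfl, Iff.rfl, Iff.rfl, Iff.rfl⟩

/-- [folklore] HYPOTHESIS SHAPE `OpBudgetB ctr BOp` (ONE run, displayed; printed KIND: [Balaban1988RG2Cluster] p. 3 (1.5) «we can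
replace the propagators by arbitrary operators having the same regularity properties and satisfying the same bounds», (1.7)
«This bound holds for all operator norms in formulations of theorems in [13]» — one run, uniformly in the spacing; NOT PRINTED
as a statement about a class centre): run B's step-`k` operator datum lies within `BOp k` of the centre's operator component. -/
def OpBudgetB (W : Set (ℕ → ℝ)) (ctr : ℕ → (ℕ → ℝ) → C.BgB → Op × Hist) (BOp : ℕ → ℝ) : Prop :=
  ∀ k, ∀ g ∈ W, ∀ U : C.BgB, ‖M.opB g U k - (ctr k g U).1‖ ≤ BOp k

/-- [folklore] HYPOTHESIS SHAPE `HistBudgetB EB ctr BHist` (ONE run, displayed — the B-twin of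
`T4InputCauchyRateSecant.HistBudgetA`; printed KIND: [Balaban1988RG2Cluster] Lemma 2 p. 11 places the run's OWN total potential in
the budget of the weighted norms (1.36) p. 9 ∕ (1.43) p. 11, uniformly in the lattice spacing; NOT PRINTED as a statement about a
class centre): run B's inserted history at step `k` lies within `BHist k` of the centre's history component. -/
def HistBudgetB (EB : Functional C C.BgB) (W : Set (ℕ → ℝ)) (ctr : ℕ → (ℕ → ℝ) → C.BgB → Op × Hist)
    (BHist : ℕ → ℝ) : Prop :=
  ∀ k, ∀ g ∈ W, ∀ U : C.BgB, ‖(M.dataB EB g U k).2 - (ctr k g U).2‖ ≤ BHist k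

variable {M}

omit [NormedSpace ℂ Op] [NormedSpace ℂ Hist] in
/-- [folklore] Membership in the budget box, unfolded. -/
theorem mem_ballClass_iff {ctr : ℕ → (ℕ → ℝ) → C.BgB → Op × Hist} {ROp RHist : ℕ → ℝ} {k : ℕ} {g : ℕ → ℝ} {U : C.BgB}
    {p : Op × Hist} :
    p ∈ ballClass ctr ROp RHist k g U ↔ ‖p.1 - (ctr k g U).1‖ ≤ ROp k ∧ ‖p.2 - (ctr k g U).2‖ ≤ RHist k := by
  rw [ballClass, Set.mem_prod, mem_closedBall, mem_closedBall, dist_eq_norm, dist_eq_norm]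

/-- [folklore] **`BaseBudget` BY CONSTRUCTION** for the budget-box base. -/
theorem baseBudget_of_hasBudgetBase {ctr : ℕ → (ℕ → ℝ) → C.BgB → Op × Hist} {BOp BHist : ℕ → ℝ}
    (h : HasBudgetBase M ctr BOp BHist) (W : Set (ℕ → ℝ)) : BaseBudget M W ctr BOp BHist := by
  intro k g _ U p hp
  rw [h k g U] at hp
  exact mem_ballClass_iff.1 hp

/-- [folklore] **LEAF L03 IS THE PAIR OF RUN B'S ONE-RUN BUDGETS**: for the budget-box base,
`InBase EB W ↔ OpBudgetB W ctr BOp ∧ HistBudgetB EB W ctr BHist`. -/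
theorem inBase_iff_budgets {ctr : ℕ → (ℕ → ℝ) → C.BgB → Op × Hist} {BOp BHist : ℕ → ℝ} (h : HasBudgetBase M ctr BOp BHist)
    {EB : Functional C C.BgB} {W : Set (ℕ → ℝ)} :
    M.InBase EB W ↔ OpBudgetB M W ctr BOp ∧ HistBudgetB M EB W ctr BHist := by
  constructor
  · intro hb
    exact ⟨fun k g hg U => (mem_ballClass_iff.1 (h k g U ▸ hb k g hg U)).1,
      fun k g hg U => (mem_ballClass_iff.1 (h k g U ▸ hb k g hg U)).2⟩
  · rintro ⟨hop, hhist⟩ k g hg U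
    rw [h k g U, mem_ballClass_iff]
    exact ⟨hop k g hg U, hhist k g hg U⟩

/-- [folklore] `InBase` from the two one-run budgets (the direction the END faces consume). -/
theorem inBase_of_budgets {ctr : ℕ → (ℕ → ℝ) → C.BgB → Op × Hist} {BOp BHist : ℕ → ℝ} (h : HasBudgetBase M ctr BOp BHist)
    {EB : Functional C C.BgB} {W : Set (ℕ → ℝ)} (hop : OpBudgetB M W ctr BOp) (hhist : HistBudgetB M EB W ctr BHist) :
    M.InBase EB W :=
  (inBase_iff_budgets h).2 ⟨hop, hhist⟩

/-- [folklore] MINIMALITY: for ANY base, `InBase ∧ BaseBudget ctr BOp BHist` give the two budgets — run B's data lie in the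
budget box; so the budget box is the least base carrying the pair of binders the budget∕secant END faces consume. -/
theorem budgets_of_inBase_baseBudget {ctr : ℕ → (ℕ → ℝ) → C.BgB → Op × Hist} {BOp BHist : ℕ → ℝ} {EB : Functional C C.BgB}
    {W : Set (ℕ → ℝ)} (hbase : M.InBase EB W) (hbud : BaseBudget M W ctr BOp BHist) :
    OpBudgetB M W ctr BOp ∧ HistBudgetB M EB W ctr BHist :=
  ⟨fun k g hg U => (hbud k g hg U _ (hbase k g hg U)).1, fun k g hg U => (hbud k g hg U _ (hbase k g hg U)).2⟩

/-- [folklore] Monotonicity of the history budget in the radius. -/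
theorem histBudgetB_mono {EB : Functional C C.BgB} {W : Set (ℕ → ℝ)} {ctr : ℕ → (ℕ → ℝ) → C.BgB → Op × Hist}
    {BHist BHist' : ℕ → ℝ} (h : HistBudgetB M EB W ctr BHist) (hle : ∀ k, BHist k ≤ BHist' k) :
    HistBudgetB M EB W ctr BHist' :=
  fun k g hg U => (h k g hg U).trans (hle k)

/-- [folklore] **SLACK OF THE ROOMY BALL CLASS** for the budget-box base: radii at least budget plus margin, species by species,
put the two-margin box around every base point inside `ballClass ctr ROp RHist` (`boxInClass_of_baseBudget` BY NAME) — the class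
on which the wall O2 (`ClassBound` ∕ `ClassLineAnalytic`) is to be asserted (RULE R6; record §27: `RHist = λE₀ ≥ μE₀ + rHist`). -/
theorem boxInClass_of_hasBudgetBase {ctr : ℕ → (ℕ → ℝ) → C.BgB → Op × Hist} {BOp BHist ROp RHist : ℕ → ℝ}
    (h : HasBudgetBase M ctr BOp BHist) (W : Set (ℕ → ℝ)) (hOp : ∀ k, BOp k + M.rOp k ≤ ROp k)
    (hHist : ∀ k, BHist k + M.rHist k ≤ RHist k) : BoxInClass M (ballClass ctr ROp RHist) W :=
  boxInClass_of_baseBudget (baseBudget_of_hasBudgetBase h W) hOp hHist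

end BudgetBox

/-! ## §2 The self-centred operator dictionary: budget `0` -/

section SelfCentred

variable (M : StepModel C Op Hist)

/-- [folklore] The SELF-CENTRED class centre: operator component = run B's own step-`k` operators (the dictionary of
`T4InputCauchyRateSpecies.BaseBudget`: «the centre's operators ARE the step's operators»), history component = a reference history
`h₀ g U k` (for [II]: the table-independent part of the inserted potentials — the base part of the linear class, §3). -/
def selfCtr (h₀ : (ℕ → ℝ) → C.BgB → ℕ → Hist) : ℕ → (ℕ → ℝ) → C.BgB → Op × Hist :=
  fun k g U => (M.opB g U k, h₀ g U k)

/-- [folklore] The two components of the self-centred centre. -/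
@[simp] theorem selfCtr_apply (h₀ : (ℕ → ℝ) → C.BgB → ℕ → Hist) (k : ℕ) (g : ℕ → ℝ) (U : C.BgB) :
    (selfCtr M h₀ k g U).1 = M.opB g U k ∧ (selfCtr M h₀ k g U).2 = h₀ g U k := ⟨rfl, rfl⟩

/-- [folklore] **Operator budget `0` about the self-centred centre** (`sub_self`): in this dictionary the operator half of leaf L03
is EMPTY — the operator species enter the class reading only through the ROOM `rOp ≤ ROp` (wall O2-op), never through a budget. -/
theorem opBudgetB_selfCtr (h₀ : (ℕ → ℝ) → C.BgB → ℕ → Hist) (W : Set (ℕ → ℝ)) : OpBudgetB M W (selfCtr M h₀) 0 := by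
  intro k g _ U
  rw [(selfCtr_apply M h₀ k g U).1, sub_self, norm_zero, Pi.zero_apply]

end SelfCentred

/-! ## §3 The (1.36) mechanism: history budgets from the linear insertion class and the printed one-run levels -/

section LinearBudget

variable {M : StepModel C Op Hist}

/-- [folklore] HYPOTHESIS SHAPE `VecBudget L W κ V` (ONE run; a CONSEQUENCE of the displayed W3 binder `AgeBudget` —
`vecBudget_of_ageBudget` — displayed separately because the total is all leaf L03 needs): the `e^{−κd}`-weighted ℓ¹ TOTAL of the
step-`k` insertion vectors is at most `V k`.  Printed KIND: the age bookkeeping of [Balaban1988RG2Cluster] p. 8–9 summed over the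
earlier scales («the factor Lʲη, which controls the sum over j», p. 9). -/
def VecBudget (L : LinearInsertion C Hist) (W : Set (ℕ → ℝ)) (κ : ℝ) (V : ℕ → ℝ) : Prop :=
  ∀ k, ∀ g ∈ W, ∀ U : C.BgB, ∑ Y ∈ L.dom k, Real.exp (-(κ * C.d Y)) * ‖L.vec g U k Y‖ ≤ V k

/-- [folklore] The geometric AGE SUM in the natural normalisation: `Σ_{j<k} ω^{k−1−j} = Σ_{m<k} ω^m ≤ 1/(1 − ω)` (`0 ≤ ω < 1`). -/
theorem sum_pow_age_pred_le {ω : ℝ} (hω : 0 ≤ ω) (hω1 : ω < 1) (k : ℕ) : ∑ j ∈ range k, ω ^ (k - 1 - j) ≤ 1 / (1 - ω) := by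
  rw [sum_range_reflect (fun m => ω ^ m) k, one_div]
  exact sum_le_hasSum _ (fun n _ => pow_nonneg hω n) (hasSum_geometric_of_lt_one hω hω1)

/-- [folklore] **THE TOTAL BUDGET FROM THE AGE BUDGET**: `AgeBudget L M W κ c ω ∧ 0 ≤ c ∧ 0 ≤ ω < 1 ⟹ VecBudget L W κ
(k ↦ rHist k · c/(1 − ω))` — split the earlier domains by scale (all `< k`), the age budget scale by scale, the geometric sum. -/
theorem vecBudget_of_ageBudget {L : LinearInsertion C Hist} {W : Set (ℕ → ℝ)} {κ c ω : ℝ} (hb : L.AgeBudget M W κ c ω)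
    (hc : 0 ≤ c) (hω : 0 ≤ ω) (hω1 : ω < 1) : VecBudget L W κ fun k => M.rHist k * (c / (1 - ω)) := by
  intro k g hg U
  have hmaps : ∀ Y ∈ L.dom k, C.scale Y ∈ range k := fun Y hY => mem_range.2 (L.dom_lt k Y hY)
  rw [← sum_fiberwise_of_maps_to hmaps]
  have hstep : ∀ j ∈ range k,
      ∑ Y ∈ (L.dom k).filter (fun Y => C.scale Y = j), Real.exp (-(κ * C.d Y)) * ‖L.vec g U k Y‖ ≤
        M.rHist k * (c * ω ^ (k - 1 - j)) := fun j hj => hb k g hg U j (mem_range.1 hj)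
  calc ∑ j ∈ range k, ∑ Y ∈ (L.dom k).filter (fun Y => C.scale Y = j), Real.exp (-(κ * C.d Y)) * ‖L.vec g U k Y‖
      ≤ ∑ j ∈ range k, M.rHist k * (c * ω ^ (k - 1 - j)) := sum_le_sum hstep
    _ = M.rHist k * (c * ∑ j ∈ range k, ω ^ (k - 1 - j)) := by rw [mul_sum, mul_sum]
    _ ≤ M.rHist k * (c * (1 / (1 - ω))) :=
        mul_le_mul_of_nonneg_left (mul_le_mul_of_nonneg_left (sum_pow_age_pred_le hω hω1 k) hc) (M.rHist_pos k).le
    _ = M.rHist k * (c / (1 - ω)) := by rw [mul_one_div]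

/-- [folklore] **A TABLE OF ONE-RUN LEVEL `T` MOVES THE INSERTED HISTORY OFF ITS BASE PART BY AT MOST `T`·(TOTAL WEIGHTED BUDGET)**
(triangle inequality over the earlier domains — the (1.36) mechanism of [II] Lemma 1∕2 in the model: the budget of the inserted
potential from the level of the earlier actions and the size of the localisation vectors). -/
theorem norm_ins_sub_base_le (L : LinearInsertion C Hist) (g : ℕ → ℝ) (U : C.BgB) (k : ℕ) {κ T : ℝ} {t : C.Dom → ℝ}
    (ht : ∀ Y ∈ L.dom k, |t Y| ≤ T * Real.exp (-(κ * C.d Y))) :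
    ‖L.ins g U k t - L.base g U k‖ ≤ T * ∑ Y ∈ L.dom k, Real.exp (-(κ * C.d Y)) * ‖L.vec g U k Y‖ := by
  rw [LinearInsertion.ins, add_sub_cancel_left, mul_sum]
  refine (norm_sum_le _ _).trans (sum_le_sum fun Y hY => ?_)
  rw [norm_smul, Complex.norm_real, Real.norm_eq_abs]
  calc |t Y| * ‖L.vec g U k Y‖ ≤ T * Real.exp (-(κ * C.d Y)) * ‖L.vec g U k Y‖ :=
        mul_le_mul_of_nonneg_right (ht Y hY) (norm_nonneg _)
    _ = T * (Real.exp (-(κ * C.d Y)) * ‖L.vec g U k Y‖) := by ring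

/-- [folklore] The same with a total budget `V k` and a nonnegative level. -/
theorem norm_ins_sub_base_le_of_vecBudget {L : LinearInsertion C Hist} {W : Set (ℕ → ℝ)} {κ T : ℝ} {V : ℕ → ℝ}
    (hv : VecBudget L W κ V) (hT : 0 ≤ T) {k : ℕ} {g : ℕ → ℝ} (hg : g ∈ W) (U : C.BgB) {t : C.Dom → ℝ}
    (ht : ∀ Y ∈ L.dom k, |t Y| ≤ T * Real.exp (-(κ * C.d Y))) : ‖L.ins g U k t - L.base g U k‖ ≤ T * V k :=
  (norm_ins_sub_base_le L g U k ht).trans (mul_le_mul_of_nonneg_left (hv k g hg U) hT)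

/-- [folklore] **RUN B'S HISTORY BUDGET FROM THE PRINTED ONE-RUN LEVEL (leaf L06) THROUGH THE LINEAR CLASS**: run B's insertion
reads the linear class `LB` (`ReadsB`), its vectors have total weighted budget `V`, run B's outputs obey `DecayBound EB W E₀ κ`
([Balaban1987RG1] (1.18) p. 263, quoted as a hypothesis SHAPE — leaf L06), `0 ≤ E₀`, and the centre's history component is the
class's base part ⟹ `HistBudgetB EB W ctr (k ↦ E₀·V k)`. -/
theorem histBudgetB_of_linear {LB : LinearInsertion C Hist} {W : Set (ℕ → ℝ)} {EB : Functional C C.BgB}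
    {ctr : ℕ → (ℕ → ℝ) → C.BgB → Op × Hist} {κ E₀ : ℝ} {V : ℕ → ℝ} (hB : ReadsB LB M W) (hv : VecBudget LB W κ V)
    (hdB : DecayBound EB W E₀ κ) (hE₀ : 0 ≤ E₀) (hctr : ∀ k (g : ℕ → ℝ) (U : C.BgB), (ctr k g U).2 = LB.base g U k) :
    HistBudgetB M EB W ctr fun k => E₀ * V k := by
  intro k g hg U
  change ‖M.insB g U k (tableB EB g U) - (ctr k g U).2‖ ≤ E₀ * V k
  rw [hB k g hg U, hctr k g U]
  exact norm_ins_sub_base_le_of_vecBudget hv hE₀ hg U fun Y _ => hdB g hg U Y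

/-- [folklore] **THE A-TWIN, feeding the secant face's `HistBudgetA` BY NAME**: run A's insertion reads the linear class `LA`
(total budget `VA`), run A's outputs obey `DecayBound EA W EA₀ κ` (leaf L05), the two runs' base parts differ by the displayed
NE2-TYPE rate `BaseRate LA LB M W δb θ` (`InsertionLinearRate`), and the centre's history component is run B's base part ⟹
`HistBudgetA M ctr EA W (k ↦ δb·θ^k·rHist k + EA₀·VA k)`. -/
theorem histBudgetA_of_linear {LA LB : LinearInsertion C Hist} {W : Set (ℕ → ℝ)} {EA : Functional C C.BgA}
    {ctr : ℕ → (ℕ → ℝ) → C.BgB → Op × Hist} {κ EA₀ δb θ : ℝ} {VA : ℕ → ℝ} (hA : LA.Reads M W) (hv : VecBudget LA W κ VA)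
    (hdA : DecayBound EA W EA₀ κ) (hEA₀ : 0 ≤ EA₀) (hbr : BaseRate LA LB M W δb θ)
    (hctr : ∀ k (g : ℕ → ℝ) (U : C.BgB), (ctr k g U).2 = LB.base g U k) :
    HistBudgetA M ctr EA W fun k => δb * θ ^ k * M.rHist k + EA₀ * VA k := by
  intro k g hg U
  change ‖M.insA g U k (tableA EA g U) - (ctr k g U).2‖ ≤ δb * θ ^ k * M.rHist k + EA₀ * VA k
  rw [hA k g hg U, hctr k g U]
  calc ‖LA.ins g U k (tableA EA g U) - LB.base g U k‖
      ≤ ‖LA.ins g U k (tableA EA g U) - LA.base g U k‖ + ‖LA.base g U k - LB.base g U k‖ :=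
        norm_sub_le_norm_sub_add_norm_sub _ _ _
    _ ≤ EA₀ * VA k + δb * θ ^ k * M.rHist k :=
        add_le_add (norm_ins_sub_base_le_of_vecBudget hv hEA₀ hg U fun Y _ => hdA g hg (C.transport U) Y) (hbr k g hg U)
    _ = δb * θ ^ k * M.rHist k + EA₀ * VA k := add_comm _ _

end LinearBudget

/-! ## §4 Assembled: leaf L03 (and `BaseBudget`) from the installed budget box, the operator budget, L06 and W3's binder -/

section Assembled

variable {M : StepModel C Op Hist}

/-- [folklore] **LEAF L03 FROM DISPLAYED ONE-RUN INPUTS**: budget-box base `HasBudgetBase ctr BOp BHist` with centre history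
component `LB.base`; operators within budget (`OpBudgetB`); run B's insertion linear (`ReadsB`) with total vector budget `V`;
run B's one-run level `DecayBound EB W E₀ κ` (leaf L06); and `E₀·V k ≤ BHist k` ⟹ `M.InBase EB W`. -/
theorem inBase_of_linear {ctr : ℕ → (ℕ → ℝ) → C.BgB → Op × Hist} {BOp BHist : ℕ → ℝ} (h : HasBudgetBase M ctr BOp BHist)
    {W : Set (ℕ → ℝ)} {EB : Functional C C.BgB} {LB : LinearInsertion C Hist} {κ E₀ : ℝ} {V : ℕ → ℝ}
    (hop : OpBudgetB M W ctr BOp) (hB : ReadsB LB M W) (hv : VecBudget LB W κ V) (hdB : DecayBound EB W E₀ κ)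
    (hE₀ : 0 ≤ E₀) (hctr : ∀ k (g : ℕ → ℝ) (U : C.BgB), (ctr k g U).2 = LB.base g U k) (hBH : ∀ k, E₀ * V k ≤ BHist k) :
    M.InBase EB W :=
  inBase_of_budgets h hop (histBudgetB_mono (histBudgetB_of_linear hB hv hdB hE₀ hctr) hBH)

/-- [folklore] The budget box of the self-centred, age-budgeted instance: centre `selfCtr M LB.base`, budgets
`(0, E₀·rHist k·c/(1 − ω))`. -/
def selfBudgetBase (M : StepModel C Op Hist) (LB : LinearInsertion C Hist) (E₀ c ω : ℝ) :
    ℕ → (ℕ → ℝ) → C.BgB → Set (Op × Hist) :=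
  ballClass (selfCtr M LB.base) 0 fun k => E₀ * (M.rHist k * (c / (1 - ω)))

/-- [folklore] **THE SELF-CENTRED, AGE-BUDGETED INSTANCE** — the form rows O1-b∕O1-c∕O1-e can plug in directly: install
`selfBudgetBase M LB E₀ c ω`; then from run B's linear reading `ReadsB`, ITS age budget `AgeBudget LB M W κ c ω` (the W3-KIND
one-run binder, for run B's insertion), the printed level `DecayBound EB W E₀ κ` (L06) and the signs, BOTH `InBase` (L03) and
`BaseBudget` hold for the installed model — every other END-face binder transferring from `M` unchanged (§1 `withBase_*`). -/
theorem inBase_baseBudget_of_selfCtr_ageBudget {W : Set (ℕ → ℝ)} {EB : Functional C C.BgB} {LB : LinearInsertion C Hist}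
    {κ E₀ c ω : ℝ} (hB : ReadsB LB M W) (hb : LB.AgeBudget M W κ c ω) (hdB : DecayBound EB W E₀ κ) (hE₀ : 0 ≤ E₀)
    (hc : 0 ≤ c) (hω : 0 ≤ ω) (hω1 : ω < 1) :
    (M.withBase (selfBudgetBase M LB E₀ c ω)).InBase EB W ∧
      BaseBudget (M.withBase (selfBudgetBase M LB E₀ c ω)) W (selfCtr M LB.base) 0
        fun k => E₀ * (M.rHist k * (c / (1 - ω))) := by
  have h : HasBudgetBase (M.withBase (selfBudgetBase M LB E₀ c ω)) (selfCtr M LB.base) 0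
      fun k => E₀ * (M.rHist k * (c / (1 - ω))) :=
    hasBudgetBase_withBase M _ _ _
  have hv : VecBudget LB W κ fun k => M.rHist k * (c / (1 - ω)) := vecBudget_of_ageBudget hb hc hω hω1
  exact ⟨inBase_of_linear h (opBudgetB_selfCtr _ LB.base W) hB hv hdB hE₀ (fun _ _ _ => rfl) fun _ => le_rfl,
    baseBudget_of_hasBudgetBase h W⟩

/-- [folklore] **ROOM ⟹ SLACK for the self-centred instance**: class radii `ROp k ≥ rOp k` (operators: room only) and
`RHist k ≥ E₀·rHist k·c/(1 − ω) + rHist k` (history: budget + margin — record §27's `λE₀ ≥ μE₀ + (λ − μ)E₀`) put the two-margin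
box around every base point of the installed model inside `ballClass (selfCtr M LB.base) ROp RHist` — where O2 is to be asserted. -/
theorem boxInClass_of_selfCtr {W : Set (ℕ → ℝ)} {LB : LinearInsertion C Hist} {E₀ c ω : ℝ} {ROp RHist : ℕ → ℝ}
    (hOp : ∀ k, M.rOp k ≤ ROp k) (hHist : ∀ k, E₀ * (M.rHist k * (c / (1 - ω))) + M.rHist k ≤ RHist k) :
    BoxInClass (M.withBase (selfBudgetBase M LB E₀ c ω)) (ballClass (selfCtr M LB.base) ROp RHist) W :=
  boxInClass_of_hasBudgetBase (hasBudgetBase_withBase M _ _ _) W (fun k => by rw [Pi.zero_apply, zero_add]; exact hOp k)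
    hHist

end Assembled

/-! ## §5 Toy: non-vacuity of §4, and the one-run history budget is a genuine hypothesis -/

section Toy

open Summit.QuantumFields.BalabanUV.T4Continuum.InsertionLinearClass (linToyCarriers toyIns toy_ageBudget)

/-- [folklore] Toy step model on the class file's toy carriers (`Dom = ℕ`, `scale = id`, `d = 0`): scalar data, output = operator
datum plus history datum, both runs' operators `0`, both runs' insertions = the toy linear insertion `toyIns ω` (vectors
`ω^{k−1−Y}`, no base part), PLACEHOLDER base `univ` (replaced by the installer), unit margins. -/
noncomputable def toyStep (ω : ℝ) : StepModel linToyCarriers ℂ ℂ where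
  Out := fun _ o h _ => o + h
  opA := fun _ _ _ => 0
  opB := fun _ _ _ => 0
  insA := (toyIns ω).ins
  insB := (toyIns ω).ins
  Base := fun _ _ _ => Set.univ
  rOp := fun _ => 1
  rHist := fun _ => 1
  rOp_pos := fun _ => one_pos
  rHist_pos := fun _ => one_pos

/-- [folklore] Toy run-B functional: every output equals `1` (level `E₀ = 1` at `κ = 0`). -/
def toyEB : Functional linToyCarriers linToyCarriers.BgB := fun _ _ _ => 1

/-- [folklore] The toy's one-run level: `DecayBound toyEB univ 1 0`. -/
theorem toy_decayB : DecayBound toyEB (Set.univ : Set (ℕ → ℝ)) 1 0 := by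
  intro g _ U X
  simp [toyEB]

/-- [folklore] The toy reads the toy linear class (run B). -/
theorem toy_readsB (ω : ℝ) : ReadsB (toyIns ω) (toyStep ω) Set.univ := fun _ _ _ _ _ => rfl

/-- [folklore] **NON-VACUITY OF §4**: at any age damping `0 ≤ ω < 1` the installed toy satisfies `InBase toyEB univ ∧ BaseBudget`
— every hypothesis of `inBase_baseBudget_of_selfCtr_ageBudget` met (`toy_ageBudget` of the class file, `c = 1`). -/
theorem toy_inBase_baseBudget {ω : ℝ} (hω : 0 ≤ ω) (hω1 : ω < 1) :
    ((toyStep ω).withBase (selfBudgetBase (toyStep ω) (toyIns ω) 1 1 ω)).InBase toyEB Set.univ ∧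
      BaseBudget ((toyStep ω).withBase (selfBudgetBase (toyStep ω) (toyIns ω) 1 1 ω)) Set.univ
        (selfCtr (toyStep ω) (toyIns ω).base) 0 fun k => 1 * ((toyStep ω).rHist k * (1 / (1 - ω))) :=
  inBase_baseBudget_of_selfCtr_ageBudget (toy_readsB ω) (toy_ageBudget (toyStep ω) (fun _ => rfl) hω 0 Set.univ)
    toy_decayB zero_le_one zero_le_one hω hω1

end Toy

end Summit.QuantumFields.BalabanUV.T4Continuum.B13Base
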